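import Summits.BirchSwinnertonDyer.BirchSwinnertonDyer.Theses.TameQuarticManinParity
import Literature.NumberTheory.ModularSymbols.CuspidalHomologyHeckeTransfer
import Literature.NumberTheory.ModularSymbols.CuspidalHomologyFixedCuspSymbolHecke
import HarnessLib

/-!
# Route `TameQuarticManinParity`: E32b `FixedPointSymbolHeckeShift` (stmt-BirchSwinnertonDyer-23757) BY NAME —
# registered stub `stub_fixedPointSymbolHeckeShift` of the crux MS (stmt-23367), line `abelian-fixed-points`

Lead seat `cruxlead-stmt-BirchSwinnertonDyer-23367` g2.  ASSEMBLY of E32b from its two halves: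
* PARABOLIC (`|3(a + d) − c| = 6`, the `t`-fixed cusps): `heckeT_sub_two_smul_symbolInt_mem_shiftSubOneLattice_of_parabolic`
  (`CuspidalHomologyFixedCuspSymbolHecke`, p681466: fixed cusp, cusp transport, `T_p^∨(t_* − 1)Φ(x)`);
* ELLIPTIC (`|3(a + d) − c| ≤ 3`, the CM points by `ℤ[ζ₃]`): the typer's level-`N/3` trace identity
  `Σ_l Ψ̄(e'_l) = 2Ψ̄(e)` for `e ∈ Γ₀(N/3)` with `|tr e| ≤ 1`
  (`sum_liftedSymbol_heckePermElt_sub_two_smul_mem_of_abs_trace_le_one`, `CuspidalHomologyHeckeTransfer`, typer tqmp-ty1 g30: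
  norm-`p` elements `λ = u + ve` of `ℤ[e]`, the two fixed cosets, `e'_l` conjugate to `e`), fed into the typer's reduction
  `T_sub_two_smul_symbolInt_mem_shiftSubOneLattice_of` restricted to `|tr e| ≤ 1` (`T_sub_two_smul_symbolInt_mem_of_elliptic`,
  its proof verbatim).
THEOREMS ONLY; no definition, no named fact, no `sorry`: E32b is PROVED UNCONDITIONALLY.  No summit is proved; BSD is NOT proved.
-/

set_option autoImplicit false
-- D-0017: single-problem summit, so `Summit.BirchSwinnertonDyer.BirchSwinnertonDyer.…` repeats a namespace BY DESIGN.
set_option linter.dupNamespace false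

noncomputable section

open scoped MatrixGroups ModularForm
open CongruenceSubgroup
open Literature.NumberTheory.EllipticCurves.ModularForms Literature.NumberTheory.ModularSymbols
  Literature.NumberTheory.EllipticCurves.ModularForms.HidaCohomology

namespace Summit.BirchSwinnertonDyer.BirchSwinnertonDyer.Theorems.TameQuarticManinParity

open Summit.BirchSwinnertonDyer.BirchSwinnertonDyer.Theses.TameQuarticManinParity

/-- **Reduction of E32b on the elliptic rows to the level-`N/3` trace identity** (the typer's
`T_sub_two_smul_symbolInt_mem_shiftSubOneLattice_of` with its hypothesis restricted to `|tr e| ≤ 1`): if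
`Σ_{l ∈ I_p(N/3)} Ψ(e'_l) ≡ 2Ψ(e) (mod Λ₁)` for every `e ∈ Γ₀(N/3)` with `|tr e| ≤ 1`, then `(T_p − 2){∞, γ∞} ∈ Λ₁` for every
`γ ∈ Γ₀(N)` with `|3(a + d) − c| ≤ 3` (`DγD⁻¹ = T e`, `3 tr e = 3(a + d) − c`). [cite: Knapp1993, (11.38), Prop. 11.23 and (11.39a) (PDF p. 244)] -/
theorem T_sub_two_smul_symbolInt_mem_of_elliptic (N : ℕ) [NeZero N] (h9 : 3 ^ 2 ∣ N) {p : ℕ} [NeZero p]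
    (hp : p.Prime) (hp3 : p ≠ 3)
    (H : ∀ e : Gamma0 (N / 3), |(e : SL(2, ℤ)) 0 0 + (e : SL(2, ℤ)) 1 1| ≤ 1 →
      ∑ l : HeckeIdx (N / 3) p, liftedSymbol N h9 (heckePermElt hp e l) -
          2 • liftedSymbol N h9 e ∈ shiftSubOneLattice N h9)
    (γ : Gamma0 N) (hγ : |3 * ((γ : SL(2, ℤ)) 0 0 + (γ : SL(2, ℤ)) 1 1) - (γ : SL(2, ℤ)) 1 0| ≤ 3) :
    (HeckeRing0.T N 2 p hp - 2) • symbolInt N γ ∈ shiftSubOneLattice N h9 := by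
  -- verbatim the typer's `T_sub_two_smul_symbolInt_mem_shiftSubOneLattice_of`, with `|tr e| ≤ 1`
  set e : Gamma0 (N / 3) := (gamma0T (N / 3))⁻¹ *
    Gamma0.degeneracyConj (N / 3) N 3 (div_three_mul_three_dvd' h9) γ with he
  have hTe : gamma0T (N / 3) * e = Gamma0.degeneracyConj (N / 3) N 3 (div_three_mul_three_dvd' h9) γ := by
    rw [he, mul_inv_cancel_left]
  have htr : |(e : SL(2, ℤ)) 0 0 + (e : SL(2, ℤ)) 1 1| ≤ 1 := by
    have h3 := three_mul_trace_gamma0T_inv_mul_degeneracyConj N h9 γ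
    rw [← he] at h3
    have : 3 * |(e : SL(2, ℤ)) 0 0 + (e : SL(2, ℤ)) 1 1| ≤ 3 := by
      rw [show (3 : ℤ) * |(e : SL(2, ℤ)) 0 0 + (e : SL(2, ℤ)) 1 1| =
        |3 * ((e : SL(2, ℤ)) 0 0 + (e : SL(2, ℤ)) 1 1)| by rw [abs_mul]; norm_num, h3]
      exact hγ
    omega
  have hγe : symbolInt N γ = shiftInt N h9 (liftedSymbol N h9 e) := by
    rw [← liftedSymbol_degeneracyConj N h9 γ, ← hTe, liftedSymbol_gamma0T_mul]
  have hA := T_smul_liftedSymbol_sub_sum_mem N h9 hp hp3 (gamma0T (N / 3) * e)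
  have hB : ∑ l : HeckeIdx (N / 3) p, liftedSymbol N h9 (heckePermElt hp (gamma0T (N / 3) * e) l) -
      ∑ l : HeckeIdx (N / 3) p, liftedSymbol N h9 (heckePermElt hp e l) ∈ shiftSubOneLattice N h9 := by
    have h := sum_liftedSymbol_heckePermElt_mul_sub_mem N h9 hp (gamma0T (N / 3)) e
    rwa [sum_liftedSymbol_heckePermElt_eq_zero_of_apply_one_zero N h9 hp
      (g := gamma0T (N / 3)) (by simp [ModularGroup.T]), sub_zero] at h
  have hC := H e htr
  have hD : (2 : ℕ) • (shiftInt N h9 (liftedSymbol N h9 e) - liftedSymbol N h9 e) ∈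
      shiftSubOneLattice N h9 := by
    refine Submodule.smul_of_tower_mem _ 2 ?_
    simpa using shiftInt_pow_sub_mem_shiftSubOneLattice N h9 1 (liftedSymbol N h9 e)
  have hT : HeckeRing0.T N 2 p hp • symbolInt N γ =
      HeckeRing0.T N 2 p hp • liftedSymbol N h9 (gamma0T (N / 3) * e) := by
    rw [hγe, liftedSymbol_gamma0T_mul]
  have key : (HeckeRing0.T N 2 p hp - 2) • symbolInt N γ =
      (HeckeRing0.T N 2 p hp • liftedSymbol N h9 (gamma0T (N / 3) * e) -
          ∑ l : HeckeIdx (N / 3) p, liftedSymbol N h9 (heckePermElt hp (gamma0T (N / 3) * e) l)) +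
        (∑ l : HeckeIdx (N / 3) p, liftedSymbol N h9 (heckePermElt hp (gamma0T (N / 3) * e) l) -
          ∑ l : HeckeIdx (N / 3) p, liftedSymbol N h9 (heckePermElt hp e l)) +
        (∑ l : HeckeIdx (N / 3) p, liftedSymbol N h9 (heckePermElt hp e l) - 2 • liftedSymbol N h9 e) -
        (2 : ℕ) • (shiftInt N h9 (liftedSymbol N h9 e) - liftedSymbol N h9 e) := by
    rw [show (HeckeRing0.T N 2 p hp - 2) • symbolInt N γ =
        HeckeRing0.T N 2 p hp • symbolInt N γ - (2 : HeckeRing0 N 2) • symbolInt N γ from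
        sub_smul (HeckeRing0.T N 2 p hp) (2 : HeckeRing0 N 2) (symbolInt N γ),
      ofNat_smul_eq_nsmul, hT, ← hγe]
    simp only [two_smul, smul_sub]
    abel
  rw [key]
  exact Submodule.sub_mem _ (Submodule.add_mem _ (Submodule.add_mem _ hA hB) hC) hD

/-- **STUB E32b `FixedPointSymbolHeckeShift` (stmt-BirchSwinnertonDyer-23757) by name**: for `9 ∣ N`, a prime `p ≡ 1 (mod N)`,
`p ≠ 3`, and `γ ∈ Γ₀(N)` with `|3(a + d) − c| ≤ 6`, `(T_p − 2)·{∞, γ∞} ∈ (t − 1)Λ`.  Since `9 ∣ c`, `3 ∣ 3(a + d) − c`, so either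
`|3(a + d) − c| = 6` (parabolic: `heckeT_sub_two_smul_symbolInt_mem_shiftSubOneLattice_of_parabolic`) or `|3(a + d) − c| ≤ 3`
(elliptic: `T_sub_two_smul_symbolInt_mem_of_elliptic` + the typer's trace identity
`sum_liftedSymbol_heckePermElt_sub_two_smul_mem_of_abs_trace_le_one`, p680336/p680712 sequel).  UNCONDITIONAL.
[cite: Knapp1993, Prop. 11.23 (PDF p. 244)] [cite: CremonaAlgorithms1997, §2.4 (2.4.1)–(2.4.2) and Prop. 2.2.3] -/
theorem stub_fixedPointSymbolHeckeShift : FixedPointSymbolHeckeShift := by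
  intro N _ h9 p hp hp3 hp1N γ hγ
  set s : ℤ := 3 * ((γ : SL(2, ℤ)) 0 0 + (γ : SL(2, ℤ)) 1 1) - (γ : SL(2, ℤ)) 1 0 with hs
  have h3s : (3 : ℤ) ∣ s := by
    have h9c : ((3 : ℤ) ^ 2) ∣ (γ : SL(2, ℤ)) 1 0 := sq_dvd_entry_of_mem_Gamma0 (m := 3) h9 γ.2
    have h3c : (3 : ℤ) ∣ (γ : SL(2, ℤ)) 1 0 := (dvd_pow_self 3 two_ne_zero).trans h9c
    exact dvd_sub (dvd_mul_right 3 _) h3c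
  by_cases h6 : s ^ 2 = 36
  · exact heckeT_sub_two_smul_symbolInt_mem_shiftSubOneLattice_of_parabolic N h9 hp hp3 hp1N γ h6
  · have hle : |s| ≤ 3 := by
      obtain ⟨k, hk⟩ := h3s
      have hk2 : |k| ≤ 2 := by
        have : |s| = 3 * |k| := by rw [hk, abs_mul]; norm_num
        omega
      have hk' : k ≠ 2 ∧ k ≠ -2 := by
        constructor <;> (rintro rfl; apply h6; rw [hk]; norm_num)
      have : |k| ≤ 1 := by
        rcases hk2.lt_or_eq with h | h
        · omega
        · exfalso
          rcases abs_eq (by norm_num : (0 : ℤ) ≤ 2) |>.mp h with h' | h'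
          · exact hk'.1 h'
          · exact hk'.2 h'
      rw [hk, abs_mul]
      norm_num
      omega
    -- arithmetic of `p`: `N ∣ p − 1`, so `p ∤ N/3`, `p ≠ 2`, `p ≡ 1 (mod 3)`
    haveI : NeZero p := ⟨hp.ne_zero⟩
    have hpN' : (N : ℤ) ∣ (p : ℤ) - 1 := by
      have h := Nat.ModEq.dvd hp1N.symm
      simpa using h
    have h9N : (9 : ℤ) ∣ (N : ℤ) := by exact_mod_cast h9
    have h91 : (9 : ℤ) ∣ (p : ℤ) - 1 := h9N.trans hpN'
    have hp2 : p ≠ 2 := by rintro rfl; omega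
    have hp1 : p % 3 = 1 := by omega
    have hpM : ¬ p ∣ N / 3 := by
      intro h
      have h3 : 3 ∣ N := (dvd_pow_self 3 two_ne_zero).trans h9
      have hpN : (p : ℤ) ∣ (N : ℤ) := by exact_mod_cast h.trans (Nat.div_dvd_of_dvd h3)
      have h1 : (p : ℤ) ∣ 1 := by
        have e : (1 : ℤ) = p - (p - 1) := by ring
        rw [e]
        exact dvd_sub (dvd_refl _) (hpN.trans hpN')
      exact hp.one_lt.ne' (by exact_mod_cast Int.eq_one_of_dvd_one (by positivity) h1)
    exact T_sub_two_smul_symbolInt_mem_of_elliptic N h9 hp hp3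
      (fun e he ↦ sum_liftedSymbol_heckePermElt_sub_two_smul_mem_of_abs_trace_le_one N h9 hp hp2 hp1 hpM e he)
      γ hle

end Summit.BirchSwinnertonDyer.BirchSwinnertonDyer.Theorems.TameQuarticManinParity

end
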